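import Summits.CriticalPhenomena.PercolationContinuityZ3.Theorems.PercNearOneGluingNoHeavyLowerTailThreePointPieces
import HarnessLib

/-!
# Series pieces: one terminal separates the other two inside the piece

Support file for crux `stmt-CriticalPhenomena-4575` (`NoHeavyLowerTail`), seat `prim-l12-p1` gen 20 (`--supports stmt-CriticalPhenomena-4575`);
continuation of `…ThreePointPieces.lean` (piece structures, `piecePairs`, `isoPiece`, `pieceConn`).
Memo `run/shared/lean/prim/prim-l12/FROM-prim-l12-p1-g20-*.md`.

A SERIES PIECE with middle terminal `z` (the other two terminals being `x, y`) is a piece `i` whose non-terminal vertices split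
into an `x`-side `X` and a `y`-side (the rest) such that no pair joins `{x} ∪ X-side` to `{y} ∪ y-side`, except possibly the
terminal pair `s(x,y)` itself (which is not a pair of the piece).  Examples: a two-terminal network hanging between `x` and `z`
(`y`-side empty), a chain `x — network — z — network — y`, the empty piece.  [this work]:

* `isoPiece_of_side` (side closure): off the null event `serNull`, if `x` does not reach `z` through the pairs inside the `x`-side
  then `x` reaches neither `y` nor `z` inside the piece;
* `sep_of_midIso`: off the null event, "`z` isolated inside the piece" forces "pairwise separated inside the piece";
* `real_series`: hence `P(z isolated inside) = P(separated inside)` and, the two side events being determined by the disjoint pair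
  sets `sidePairs x z X`, `sidePairs y z (coSide X)`, `P(separated inside) = P(x isolated inside) · P(y isolated inside)`.
These two identities give the isolation criterion `(K)` for series pieces (next file, `isoK_series`), hence `(3PT)` for every
parallel composition of hubs and series pieces (`threePointVariance_of_hubs_and_series`).
-/

namespace Summit.CriticalPhenomena.PercolationContinuityZ3.Theorems.ThreePointPieces

open MeasureTheory Set
open Literature.Probability.Percolation Literature.Probability.LatticeModels

variable {V : Type*} [Fintype V] [DecidableEq V] {ι : Type*} [DecidableEq ι]

/-! ## Endpoints of piece pairs -/

/-- The endpoints of a piece pair: one is in the piece, both are in the piece or terminals. [this work] -/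
theorem mem_piecePairs_mk {a b c : V} {part : V → ι} {i : ι} {u v : V} (he : s(u, v) ∈ piecePairs a b c part i) :
    ((u ∉ terms a b c ∧ part u = i) ∨ u ∈ terms a b c) ∧ ((v ∉ terms a b c ∧ part v = i) ∨ v ∈ terms a b c) ∧
      ((u ∉ terms a b c ∧ part u = i) ∨ (v ∉ terms a b c ∧ part v = i)) := by
  obtain ⟨u', v', hu', hv', -, he'⟩ := mem_piecePairs.1 he
  rcases Sym2.eq_iff.1 he' with ⟨rfl, rfl⟩ | ⟨rfl, rfl⟩
  · exact ⟨Or.inl hu', hv', Or.inl hu'⟩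
  · exact ⟨hv', Or.inl hu', Or.inr hu'⟩


/-! ## Pieces that satisfy `(K)`: series pieces (one terminal separates the other two inside the piece) -/

section series
variable (w : Sym2 V → unitInterval) {a b c : V} (part : V → ι) (i : ι) (x y z : V) (X : Finset V)

/-- The null event of a series piece `i` with middle terminal `z`, `x`-side `X` and `y`-side the rest of the piece: some pair
between `{x} ∪ X-side` and `{y} ∪ (piece ∖ X)`, other than the terminal pair `s(x,y)`, is open. [this work] -/
def serNull (a b c : V) (part : V → ι) (i : ι) (x y : V) (X : Finset V) : Set (BondConfig V) :=
  {ω | ∃ u v, (u = x ∨ (u ∉ terms a b c ∧ part u = i ∧ u ∈ X)) ∧ (v = y ∨ (v ∉ terms a b c ∧ part v = i ∧ v ∉ X)) ∧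
    ((u ∉ terms a b c ∧ part u = i ∧ u ∈ X) ∨ (v ∉ terms a b c ∧ part v = i ∧ v ∉ X)) ∧ s(u, v) ∈ ω}

/-- The pairs of piece `i` inside the `x`-side `{x, z} ∪ X`. [this work] -/
def sidePairs (a b c : V) (part : V → ι) (i : ι) (x z : V) (X : Finset V) : Finset (Sym2 V) :=
  (piecePairs a b c part i).filter fun e => ∀ t, t ∈ e → (t = x ∨ t = z ∨ (t ∉ terms a b c ∧ part t = i ∧ t ∈ X))

/-- The complementary side, as a finset. [this work] -/
def coSide (a b c : V) (part : V → ι) (i : ι) (X : Finset V) : Finset V :=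
  Finset.univ.filter fun v => v ∉ terms a b c ∧ part v = i ∧ v ∉ X

variable {part i x y z X}

/-- Membership in `coSide`. [this work] -/
@[simp] theorem mem_coSide {v : V} : v ∈ coSide a b c part i X ↔ v ∉ terms a b c ∧ part v = i ∧ v ∉ X := by
  simp [coSide]

/-- `y`-side membership via `coSide`. [this work] -/
theorem ySide_iff {v : V} : (v ∉ terms a b c ∧ part v = i ∧ v ∈ coSide a b c part i X) ↔ (v ∉ terms a b c ∧ part v = i ∧ v ∉ X) := by
  rw [mem_coSide]; tauto

/-- `x`-side membership via `coSide`. [this work] -/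
theorem xSide_iff {v : V} : (v ∉ terms a b c ∧ part v = i ∧ v ∉ coSide a b c part i X) ↔ (v ∉ terms a b c ∧ part v = i ∧ v ∈ X) := by
  rw [mem_coSide]; tauto

/-- The null event is symmetric under exchanging the two sides. [this work] -/
theorem serNull_swap : serNull a b c part i y x (coSide a b c part i X) = serNull a b c part i x y X := by
  ext ω
  simp only [serNull, mem_setOf_eq]
  constructor
  · rintro ⟨u, v, hu, hv, huv, he⟩
    refine ⟨v, u, ?_, ?_, ?_, by rw [Sym2.eq_swap]; exact he⟩
    · rcases hv with h | h
      · exact Or.inl h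
      · exact Or.inr (xSide_iff.1 h)
    · rcases hu with h | h
      · exact Or.inl h
      · exact Or.inr (ySide_iff.1 h)
    · rcases huv with h | h
      · exact Or.inr (ySide_iff.1 h)
      · exact Or.inl (xSide_iff.1 h)
  · rintro ⟨u, v, hu, hv, huv, he⟩
    refine ⟨v, u, ?_, ?_, ?_, by rw [Sym2.eq_swap]; exact he⟩
    · rcases hv with h | h
      · exact Or.inl h
      · exact Or.inr (ySide_iff.2 h)
    · rcases hu with h | h
      · exact Or.inl h
      · exact Or.inr (xSide_iff.2 h)
    · rcases huv with h | h
      · exact Or.inr (xSide_iff.2 h)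
      · exact Or.inl (ySide_iff.2 h)

/-- A piece pair with both ends in the `x`-side is a side pair. [this work] -/
theorem mk_mem_sidePairs {u v : V} (he : s(u, v) ∈ piecePairs a b c part i)
    (hu : u = x ∨ u = z ∨ (u ∉ terms a b c ∧ part u = i ∧ u ∈ X)) (hv : v = x ∨ v = z ∨ (v ∉ terms a b c ∧ part v = i ∧ v ∈ X)) :
    s(u, v) ∈ sidePairs a b c part i x z X := by
  refine Finset.mem_filter.2 ⟨he, fun t ht => ?_⟩
  rcases Sym2.mem_iff.1 ht with rfl | rfl
  · exact hu
  · exact hv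

/-- The null event of a series piece is null when its cross pairs have weight `0`. [this work] -/
theorem real_serNull
    (hsep : ∀ u v : V, (u = x ∨ (u ∉ terms a b c ∧ part u = i ∧ u ∈ X)) → (v = y ∨ (v ∉ terms a b c ∧ part v = i ∧ v ∉ X)) →
      ((u ∉ terms a b c ∧ part u = i ∧ u ∈ X) ∨ (v ∉ terms a b c ∧ part v = i ∧ v ∉ X)) → (w s(u, v) : ℝ) = 0) :
    (prodBernoulli w).real (serNull a b c part i x y X) = 0 := by
  set P : Finset (Sym2 V) := ((Finset.univ ×ˢ Finset.univ).filter fun uv : V × V =>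
      (uv.1 = x ∨ (uv.1 ∉ terms a b c ∧ part uv.1 = i ∧ uv.1 ∈ X)) ∧
        (uv.2 = y ∨ (uv.2 ∉ terms a b c ∧ part uv.2 = i ∧ uv.2 ∉ X)) ∧
          ((uv.1 ∉ terms a b c ∧ part uv.1 = i ∧ uv.1 ∈ X) ∨ (uv.2 ∉ terms a b c ∧ part uv.2 = i ∧ uv.2 ∉ X))).image
      fun uv => s(uv.1, uv.2) with hP
  have hsub : serNull a b c part i x y X ⊆ {ω : BondConfig V | ∃ e ∈ P, e ∈ ω} := by
    rintro ω ⟨u, v, hu, hv, huv, he⟩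
    refine ⟨s(u, v), ?_, he⟩
    rw [hP, Finset.mem_image]
    exact ⟨(u, v), Finset.mem_filter.2 ⟨Finset.mem_product.2 ⟨Finset.mem_univ _, Finset.mem_univ _⟩, hu, hv, huv⟩, rfl⟩
  refine le_antisymm ?_ measureReal_nonneg
  refine (measureReal_mono hsub).trans ((prodBernoulli_real_exists_mem_le_sum w P).trans (le_of_eq (Finset.sum_eq_zero ?_)))
  intro e he
  rw [hP, Finset.mem_image] at he
  obtain ⟨⟨u, v⟩, huv, rfl⟩ := he
  rw [Finset.mem_filter] at huv
  exact hsep u v huv.2.1 huv.2.2.1 huv.2.2.2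

/-- **Side closure.**  In a series piece (middle `z`, `x`-side `X`), off the null event: if `x` does not reach `z` using the pairs of
a sub-family `F' ⊆ piecePairs i` containing every piece pair inside the `x`-side, then `x` reaches neither `y` nor `z` inside the
piece. [this work] -/
theorem isoPiece_of_side (hT : ∀ v, v ∈ terms a b c → v = x ∨ v = y ∨ v = z) (hx : x ∈ terms a b c) (hy : y ∈ terms a b c)
    (hz : z ∈ terms a b c)
    (hxy : x ≠ y) (hxz : x ≠ z) {F' : Finset (Sym2 V)}
    (hF'X : ∀ u v, s(u, v) ∈ piecePairs a b c part i → (u = x ∨ u = z ∨ (u ∉ terms a b c ∧ part u = i ∧ u ∈ X)) →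
      (v = x ∨ v = z ∨ (v ∉ terms a b c ∧ part v = i ∧ v ∈ X)) → s(u, v) ∈ F')
    {ω : BondConfig V} (hN : ω ∉ serNull a b c part i x y X) (hxz' : ω ∉ pieceConn F' x z) :
    ω ∈ isoPiece (piecePairs a b c part i) x y z := by
  set F := piecePairs a b c part i with hF
  set R : Set V := {v | v = x ∨ ((v ∉ terms a b c ∧ part v = i ∧ v ∈ X) ∧ ω ∈ pieceConn F' x v)} with hR
  have hreach : ∀ u ∈ R, ω ∈ pieceConn F' x u := by
    rintro u (rfl | ⟨-, h⟩)
    · exact SimpleGraph.Reachable.refl _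
    · exact h
  have hside : ∀ u ∈ R, u = x ∨ u = z ∨ (u ∉ terms a b c ∧ part u = i ∧ u ∈ X) := by
    rintro u (rfl | ⟨h, -⟩)
    · exact Or.inl rfl
    · exact Or.inr (Or.inr h)
  have hside' : ∀ u ∈ R, u = x ∨ (u ∉ terms a b c ∧ part u = i ∧ u ∈ X) := by
    rintro u (rfl | ⟨h, -⟩)
    · exact Or.inl rfl
    · exact Or.inr h
  have hcl : ∀ u v, (openGraph (ω ∩ ↑F)).Adj u v → u ∈ R → v ∈ R := by
    intro u v huv hu
    rw [openGraph_adj] at huv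
    obtain ⟨⟨he, heF⟩, hne⟩ := huv
    have heF' : s(u, v) ∈ F := Finset.mem_coe.1 heF
    obtain ⟨-, hv1, huv1⟩ := mem_piecePairs_mk heF'
    have step : (v = x ∨ v = z ∨ (v ∉ terms a b c ∧ part v = i ∧ v ∈ X)) → ω ∈ pieceConn F' x v := fun hv =>
      (hreach u hu).trans (SimpleGraph.Adj.reachable ((openGraph_adj _ _ _).2
        ⟨⟨he, Finset.mem_coe.2 (hF'X u v heF' (hside u hu) hv)⟩, hne⟩))
    rcases hv1 with ⟨hvT, hvi⟩ | hvT
    · by_cases hvX : v ∈ X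
      · exact Or.inr ⟨⟨hvT, hvi, hvX⟩, step (Or.inr (Or.inr ⟨hvT, hvi, hvX⟩))⟩
      · refine (hN ⟨u, v, hside' u hu, Or.inr ⟨hvT, hvi, hvX⟩, Or.inr ⟨hvT, hvi, hvX⟩, he⟩).elim
    · rcases hT v hvT with hvx | hvy | hvz
      · exact Or.inl hvx
      · -- `v = y`: a null pair, unless `u = x` — impossible for a piece pair between two terminals
        rcases hside' u hu with hux | huX
        · rcases huv1 with ⟨h, -⟩ | ⟨h, -⟩
          · exact (h (hux ▸ hx)).elim
          · exact (h hvT).elim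
        · exact (hN ⟨u, v, Or.inr huX, Or.inl hvy, Or.inl huX, he⟩).elim
      · have h' := step (Or.inr (Or.inl hvz))
        rw [hvz] at h'
        exact (hxz' h').elim
  have hstay : ∀ {u v : V} (_ : (openGraph (ω ∩ ↑F)).Walk u v), u ∈ R → v ∈ R := by
    intro u v q
    induction q with
    | nil => exact id
    | cons h' _ ih => exact fun hu => ih (hcl _ _ h' hu)
  have hyR : y ∉ R := by
    rintro (h | ⟨⟨h, -⟩, -⟩)
    · exact hxy h.symm
    · exact h hy
  have hzR : z ∉ R := by
    rintro (h | ⟨⟨h, -⟩, -⟩)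
    · exact hxz h.symm
    · exact h hz
  exact ⟨fun ⟨p⟩ => hyR (hstay p (Or.inl rfl)), fun ⟨p⟩ => hzR (hstay p (Or.inl rfl))⟩


/-- **Middle isolation forces separation.**  In a series piece with middle `z`, off the null event: if `z` reaches neither `x` nor
`y` inside the piece then the three terminals are pairwise separated inside the piece. [this work] -/
theorem sep_of_midIso (hT : ∀ v, v ∈ terms a b c → v = x ∨ v = y ∨ v = z) (hx : x ∈ terms a b c) (hy : y ∈ terms a b c)
    (hz : z ∈ terms a b c) (hxy : x ≠ y) (hxz : x ≠ z) {ω : BondConfig V} (hN : ω ∉ serNull a b c part i x y X)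
    (hmid : ω ∈ isoPiece (piecePairs a b c part i) z x y) :
    ω ∈ isoPiece (piecePairs a b c part i) x y z ∩ isoPiece (piecePairs a b c part i) y x z := by
  have hxz' : ω ∉ pieceConn (piecePairs a b c part i) x z := fun h => hmid.1 (SimpleGraph.Reachable.symm h)
  have hX : ω ∈ isoPiece (piecePairs a b c part i) x y z :=
    isoPiece_of_side hT hx hy hz hxy hxz (F' := piecePairs a b c part i) (fun u v h _ _ => h) hN hxz'
  exact ⟨hX, fun h => hX.1 (SimpleGraph.Reachable.symm h), fun h => hmid.2 (SimpleGraph.Reachable.symm h)⟩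

/-- `sidePairs ⊆ piecePairs`. [this work] -/
theorem sidePairs_subset : sidePairs a b c part i x z X ⊆ piecePairs a b c part i := Finset.filter_subset _ _

/-- **The `x`-side event.**  Off the null event, "`x` isolated inside the piece" is the event "`x` does not reach `z` through the
`x`-side pairs", which is determined by the `x`-side pairs alone. [this work] -/
theorem isoPiece_inter_eq_side (hT : ∀ v, v ∈ terms a b c → v = x ∨ v = y ∨ v = z) (hx : x ∈ terms a b c) (hy : y ∈ terms a b c)
    (hz : z ∈ terms a b c) (hxy : x ≠ y) (hxz : x ≠ z) :
    isoPiece (piecePairs a b c part i) x y z ∩ (serNull a b c part i x y X)ᶜ =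
      (pieceConn (sidePairs a b c part i x z X) x z)ᶜ ∩ (serNull a b c part i x y X)ᶜ := by
  ext ω
  simp only [mem_inter_iff, mem_compl_iff]
  constructor
  · rintro ⟨hiso, hN⟩
    refine ⟨fun h => hiso.2 (h.mono (openGraph_mono ?_)), hN⟩
    exact inter_subset_inter_right _ (Finset.coe_subset.2 sidePairs_subset)
  · rintro ⟨hE, hN⟩
    exact ⟨isoPiece_of_side hT hx hy hz hxy hxz (F' := sidePairs a b c part i x z X) (fun u v he hu hv => mk_mem_sidePairs he hu hv)
      hN hE, hN⟩

/-- The two side pair sets are disjoint. [this work] -/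
theorem disjoint_sidePairs (hx : x ∈ terms a b c) (hy : y ∈ terms a b c) (hz : z ∈ terms a b c) (hxy : x ≠ y) (hxz : x ≠ z) :
    Disjoint (sidePairs a b c part i x z X) (sidePairs a b c part i y z (coSide a b c part i X)) := by
  rw [Finset.disjoint_left]
  intro e heX heY
  obtain ⟨heF, hPX⟩ := Finset.mem_filter.1 heX
  obtain ⟨-, hPY⟩ := Finset.mem_filter.1 heY
  obtain ⟨u, v, -, -, huv, rfl⟩ := mem_piecePairs.1 heF
  have key : ∀ t, t ∈ s(u, v) → t = z := by
    intro t ht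
    rcases hPX t ht with rfl | rfl | ⟨htT, -, htX⟩
    · rcases hPY t ht with h | h | ⟨h, -, -⟩
      · exact (hxy h).elim
      · exact h
      · exact (h hx).elim
    · rfl
    · rcases hPY t ht with rfl | rfl | ⟨-, -, h⟩
      · exact (htT hy).elim
      · exact (htT hz).elim
      · exact ((mem_coSide.1 h).2.2 htX).elim
  exact huv ((key u (Sym2.mem_mk_left u v)).trans (key v (Sym2.mem_mk_right u v)).symm)

/-- **Series pieces: `P(z isolated inside) = P(separated inside)` and `P(separated inside) = P(x isolated inside)·P(y isolated inside)`.**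
[this work] -/
theorem real_series (hT : ∀ v, v ∈ terms a b c → v = x ∨ v = y ∨ v = z) (hx : x ∈ terms a b c) (hy : y ∈ terms a b c)
    (hz : z ∈ terms a b c) (hxy : x ≠ y) (hxz : x ≠ z) (hyz : y ≠ z)
    (hsep : ∀ u v : V, (u = x ∨ (u ∉ terms a b c ∧ part u = i ∧ u ∈ X)) → (v = y ∨ (v ∉ terms a b c ∧ part v = i ∧ v ∉ X)) →
      ((u ∉ terms a b c ∧ part u = i ∧ u ∈ X) ∨ (v ∉ terms a b c ∧ part v = i ∧ v ∉ X)) → (w s(u, v) : ℝ) = 0) :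
    (prodBernoulli w).real (isoPiece (piecePairs a b c part i) z x y) =
        (prodBernoulli w).real (isoPiece (piecePairs a b c part i) x y z ∩ isoPiece (piecePairs a b c part i) y x z) ∧
      (prodBernoulli w).real (isoPiece (piecePairs a b c part i) x y z ∩ isoPiece (piecePairs a b c part i) y x z) =
        (prodBernoulli w).real (isoPiece (piecePairs a b c part i) x y z) *
          (prodBernoulli w).real (isoPiece (piecePairs a b c part i) y x z) := by
  set F := piecePairs a b c part i with hF
  set N := serNull a b c part i x y X with hNdef
  have hN : (prodBernoulli w).real N = 0 := real_serNull w hsep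
  have hT' : ∀ v, v ∈ terms a b c → v = y ∨ v = x ∨ v = z := fun v hv => by rcases hT v hv with h | h | h <;> tauto
  -- the side events
  set EX : Set (BondConfig V) := (pieceConn (sidePairs a b c part i x z X) x z)ᶜ with hEX
  set EY : Set (BondConfig V) := (pieceConn (sidePairs a b c part i y z (coSide a b c part i X)) y z)ᶜ with hEY
  have eX : isoPiece F x y z ∩ Nᶜ = EX ∩ Nᶜ := isoPiece_inter_eq_side hT hx hy hz hxy hxz
  have eY : isoPiece F y x z ∩ Nᶜ = EY ∩ Nᶜ := by
    have h := isoPiece_inter_eq_side (part := part) (i := i) (X := coSide a b c part i X) hT' hy hx hz (Ne.symm hxy) hyz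
    rw [serNull_swap] at h
    exact h
  have rX : (prodBernoulli w).real (isoPiece F x y z) = (prodBernoulli w).real EX := by
    rw [← ThreePointVarianceCutVertex.real_inter_compl_of_null w hN (isoPiece F x y z), eX,
      ThreePointVarianceCutVertex.real_inter_compl_of_null w hN]
  have rY : (prodBernoulli w).real (isoPiece F y x z) = (prodBernoulli w).real EY := by
    rw [← ThreePointVarianceCutVertex.real_inter_compl_of_null w hN (isoPiece F y x z), eY,
      ThreePointVarianceCutVertex.real_inter_compl_of_null w hN]
  have rS : (prodBernoulli w).real (isoPiece F x y z ∩ isoPiece F y x z) = (prodBernoulli w).real (EX ∩ EY) := by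
    have e : (isoPiece F x y z ∩ isoPiece F y x z) ∩ Nᶜ = (EX ∩ EY) ∩ Nᶜ := by
      ext ω
      constructor
      · rintro ⟨⟨h1, h2⟩, hn⟩
        have h1' : ω ∈ EX ∩ Nᶜ := by rw [← eX]; exact ⟨h1, hn⟩
        have h2' : ω ∈ EY ∩ Nᶜ := by rw [← eY]; exact ⟨h2, hn⟩
        exact ⟨⟨h1'.1, h2'.1⟩, hn⟩
      · rintro ⟨⟨h1, h2⟩, hn⟩
        have h1' : ω ∈ isoPiece F x y z ∩ Nᶜ := by rw [eX]; exact ⟨h1, hn⟩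
        have h2' : ω ∈ isoPiece F y x z ∩ Nᶜ := by rw [eY]; exact ⟨h2, hn⟩
        exact ⟨⟨h1'.1, h2'.1⟩, hn⟩
    rw [← ThreePointVarianceCutVertex.real_inter_compl_of_null w hN (isoPiece F x y z ∩ isoPiece F y x z), e,
      ThreePointVarianceCutVertex.real_inter_compl_of_null w hN]
  have hind : (prodBernoulli w).real (EX ∩ EY) = (prodBernoulli w).real EX * (prodBernoulli w).real EY :=
    prodBernoulli_real_inter_of_determinedBy_disjoint w (disjoint_sidePairs hx hy hz hxy hxz)
      (OneLayerTwoFinger.determinedBy_compl (determinedBy_pieceConn _ x z))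
      (OneLayerTwoFinger.determinedBy_compl (determinedBy_pieceConn _ y z)) MeasurableSet.of_discrete MeasurableSet.of_discrete
  refine ⟨?_, by rw [rS, hind, rX, rY]⟩
  -- `P(z isolated inside) = P(separated inside)`
  refine le_antisymm ?_ (measureReal_mono fun ω ⟨h1, h2⟩ =>
    ⟨fun h => h1.2 (SimpleGraph.Reachable.symm h), fun h => h2.2 (SimpleGraph.Reachable.symm h)⟩)
  rw [← ThreePointVarianceCutVertex.real_inter_compl_of_null w hN (isoPiece F z x y)]
  exact measureReal_mono fun ω ⟨h, hn⟩ => sep_of_midIso hT hx hy hz hxy hxz hn h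

end series

end Summit.CriticalPhenomena.PercolationContinuityZ3.Theorems.ThreePointPieces
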